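import Literature.Analysis.FluidPDE.Vorticity
import Literature.Analysis.FluidPDE.LerayHopf
import HarnessLib

/-!
# Grujić 2009: localized ½-Hölder coherence of the vorticity direction controls the local
# enstrophy (Theorem 1)

Topic `Analysis/FluidPDE`. Source: Z. Grujić, *Localization and geometric depletion of
vortex-stretching in the 3D NSE*, Comm. Math. Phys. **290** (2009) 861–870 [Grujic2009] (held,
lit key `paper:doi-10-1007-s00220-008-0726-8`; Theorem 1 on p. 866 = lit page 6, Remarks 1–2 on
p. 869 = lit page 9, the class of Leray solutions on p. 865 = lit page 5, §2 notation p. 863).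

One of the printed vorticity-direction criteria cited as a source / nearest prior art by the N0
routes `Summit.NavierStokesRegularity.NavierStokesRegularity.Theses.ScaledTopAlignment` (crux
`AprioriScaledTopAlignment`, "Grujić 2009 Thm 1: ½-Hölder coherence on a FIXED parabolic
cylinder") and `….Theses.LocalSineTubeDoor` (the SINE, i.e. sign-blind, axis of the door): it is
the local, sign-blind (`|sin ∠(ξ(x), ξ(y))|`), `½`-Hölder member of the Constantin–Fefferman family
(`constantin_fefferman`, `gigaMiura_continuousAlignment_typeI` are the tree's other members; the
GLOBAL `½`-Hölder criterion of Beirão da Veiga–Berselli 2002 is the PROVED tree theorem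
`holderHalf_direction_criterion` of `HolderHalfDirectionCriterion` — the present LOCALIZED
statement, on one backward parabolic cylinder with a local conclusion, is not a restatement of it).

## What is printed (verbatim up to notation)

§2 (p. 863): "`uₜ − νΔu + (u·∇)u + ∇p = 0` … (In what follows, the viscosity will be set to 1 –
the results in the general case can be recovered by scaling.)"; `ω = curl u`, `ξ = ω/|ω|`;
`Q_δ(x₀, t₀) = B_δ(x₀) × (t₀ − δ², t₀)`. P. 865: "Let `u` be a Leray solution on `Ω × (0, T)`,
i.e., a weak (distributional) solution satisfying `u ∈ L^∞(0, T; L²) ∩ L²(0, T; H¹)`."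

**Theorem 1** (p. 866). "Let `Ω ⊆ ℝ³` be open, and `u` a Leray solution on the space-time domain
`Ω × (0, T)` for some `T > 0`. Fix a point `(x₀, t₀)` in `Ω × (0, T)`, and let `0 < R < 1` be such
that the open parabolic cylinder `Q_{2R}(x₀, t₀) = B(x₀, 2R) × (t₀ − (2R)², t₀)` is contained in
`Ω × (0, T)`. Suppose that `u` is smooth on `Q_{2R}(x₀, t₀)` and that there exist two positive
constants `K, M` such that the following coherence condition holds,
`|sin φ(ξ(x, t), ξ(y, t))| ≤ K |x − y|^{1/2}` for all `(x, t), (y, t)` in `Q_{2R} ∩ {|ω| > M}`.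
Then the localized enstrophy remains uniformly bounded up to `t = t₀`, i.e.,
`sup_{t ∈ (t₀−R², t₀)} ∫_{B(x₀,R)} |ω|²(x, t) dx < ∞`."

**Remark 2** (p. 869). "The theorem implies interior regularity of any Leray solution possessing
`½`-Hölder coherent vorticity direction field independently of the type of the domain or the
boundary conditions."

## Rendering choices

* The whole-space Leray–Hopf frame of the tree's other direction criteria: `Ω = ℝ³`, `ν = 1` (as
  printed), `u` a Leray–Hopf weak solution of the unforced system on `[0, T)` from `u₀`
  (`IsLerayHopfOn T 1 0 u₀ u`, which lies in Grujić's class `L^∞_t L²_x ∩ L²_t H¹_x`); the printed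
  open-domain generality `Ω ⊆ ℝ³` is not transcribed (a special case, hence implied by print).
* "`u` smooth on `Q_{2R}(x₀, t₀)`": `ContDiffOn ℝ ∞ (uncurry u) (Ioo (t₀ − (2R)²) t₀ ×ˢ ball x₀ (2R))`
  for the representative `u` (time first); `Q_{2R} ⊆ ℝ³ × (0, T)` becomes `(2R)² ≤ t₀`, `t₀ < T`
  (closed time constraints: a special case of the printed open inclusion, hence implied).
* `|sin φ(ξ(x,t), ξ(y,t))|` for the unit vectors `ξ = vorticityDirection (curl (u t))` is
  `‖ξ(x,t) × ξ(y,t)‖` (`cross`, `norm_cross`: `‖v × w‖ = ‖v‖‖w‖ sin ∠(v,w)`, the angle in `[0, π]`),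
  the tree's sign-blind rendering used by `….Theses.LocalSineTubeDoor`; `|x − y|^{1/2}` is
  `Real.sqrt ‖x − y‖`.
* Conclusion: a uniform bound on `∫_{B(x₀,R)} |curl (u t)|² dx` for `t ∈ (t₀ − R², t₀)` (the
  integrand is continuous on the ball for these `t`, so the Bochner integral is the printed one).

## What is NOT here

The proof (localized representation formula for the stretching factor `α`, §§3–4) and Remark 2's
regularity consequence; the hybrid conditions of [GrRu]/[GrZh] (Remark 1).

## References

* Z. Grujić, Comm. Math. Phys. 290 (2009) 861–870, §2, Thm 1, Rmks 1–2. [Grujic2009]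
* P. Constantin, C. Fefferman, Indiana Univ. Math. J. 42 (1993) 775–789 (the Lipschitz sine
  condition; tree `constantin_fefferman`). [ConstantinFefferman1993]
-/

noncomputable section

open MeasureTheory Set Function Filter Metric
open _root_.Topology

namespace Literature.Analysis.FluidPDE

/-- **Grujić 2009, Theorem 1** (localized ½-Hölder coherence of the vorticity direction bounds
the local enstrophy; Comm. Math. Phys. 290 (2009), p. 866: "Let `Ω ⊆ ℝ³` be open, and `u` a
Leray solution on `Ω × (0, T)` … Fix `(x₀, t₀) ∈ Ω × (0, T)`, and let `0 < R < 1` be such that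
`Q_{2R}(x₀, t₀) = B(x₀, 2R) × (t₀ − (2R)², t₀) ⊆ Ω × (0, T)`. Suppose that `u` is smooth on
`Q_{2R}(x₀, t₀)` and that there exist two positive constants `K, M` such that
`|sin φ(ξ(x,t), ξ(y,t))| ≤ K|x − y|^{1/2}` for all `(x,t), (y,t) ∈ Q_{2R} ∩ {|ω| > M}`. Then
`sup_{t ∈ (t₀−R², t₀)} ∫_{B(x₀,R)} |ω|²(x,t) dx < ∞`."). Rendering (module docstring): `Ω = ℝ³`,
`ν = 1`, `u` Leray–Hopf on `[0, T)` from `u₀` (`IsLerayHopfOn T 1 0 u₀ u`), `u` smooth on the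
backward cylinder below `(t₀, x₀)` with `(2R)² ≤ t₀ < T`, sine rendered sign-blindly as
`‖ξ(x,t) × ξ(y,t)‖` with `ξ = vorticityDirection (curl (u t))`, `|x − y|^{1/2} = √‖x − y‖`;
conclusion: `∫_{B(x₀,R)} ‖curl (u t)‖² ≤ C` for all `t ∈ (t₀ − R², t₀)`. The global criterion
(whole space, all times) is the proved `holderHalf_direction_criterion`; this localized form is not
proved here; users take `(h : grujic2009_localized_halfHolder_coherence)`. [cite: Grujic2009, Thm 1 (p. 866) with §2 (p. 863) and Remark 2 (p. 869)] -/
def grujic2009_localized_halfHolder_coherence : Prop :=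
  ∀ ⦃T : ℝ⦄, 0 < T →
    ∀ ⦃u₀ : EuclideanSpace ℝ (Fin 3) → EuclideanSpace ℝ (Fin 3)⦄
      ⦃u : ℝ → EuclideanSpace ℝ (Fin 3) → EuclideanSpace ℝ (Fin 3)⦄,
    IsLerayHopfOn T 1 0 u₀ u →
    ∀ (x₀ : EuclideanSpace ℝ (Fin 3)) (t₀ R : ℝ), 0 < R → R < 1 → (2 * R) ^ 2 ≤ t₀ → t₀ < T →
    -- `u` is smooth on the open parabolic cylinder `Q_{2R}(x₀, t₀)`
    ContDiffOn ℝ (⊤ : ℕ∞) (uncurry u) (Ioo (t₀ - (2 * R) ^ 2) t₀ ×ˢ ball x₀ (2 * R)) →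
    -- ½-Hölder (sign-blind) coherence of `ξ` on `Q_{2R} ∩ {|ω| > M}`
    (∃ K M : ℝ, 0 < K ∧ 0 < M ∧ ∀ t ∈ Ioo (t₀ - (2 * R) ^ 2) t₀,
      ∀ x ∈ ball x₀ (2 * R), ∀ y ∈ ball x₀ (2 * R),
        M < ‖curl (u t) x‖ → M < ‖curl (u t) y‖ →
          ‖cross (vorticityDirection (curl (u t)) x) (vorticityDirection (curl (u t)) y)‖ ≤
            K * Real.sqrt ‖x - y‖) →
    -- the localized enstrophy stays bounded up to `t = t₀`
    ∃ C : ℝ, ∀ t ∈ Ioo (t₀ - R ^ 2) t₀, ∫ x in ball x₀ R, ‖curl (u t) x‖ ^ 2 ≤ C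

end Literature.Analysis.FluidPDE

end
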